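import Mathlib
import HarnessLib
import Literature.AlgebraicGeometry.Resolution.DivisorialPlace
import Literature.AlgebraicGeometry.Resolution.QuadraticTransformsProofs
import Summits.ResolutionOfSingularities.ResolutionOfSingularities.Theorems.HomologicalConductorNoZenoExceptionalBasePt

/-!
# Crux `NoZeno` / `NoZenoR` (stmt-ResolutionOfSingularities-16483 / -19943), line `sandwich-cluster`,
# stub S2 — component (a): reach along `O`, finite presentation of the quadratic sequence, DVR places

OURS (cell res-hironaka, crux chain W4.4, seat res-L0-w44-stub-3); nothing here is a statement of the
manuscript under review (Hironaka 2017); AI-written, weaker than expert review.  First of three files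
proving the registered stub S2 `stub_regularOfBasePtsEmpty` (skeleton v10) scheme-free
(plan `L/res-L0-w44-stub-3/S2-PLAN.md`):

* `exists_finset_presentation_of_sequence` — members of a quadratic sequence along `O` are essentially
  finitely generated over the base: every element of `S_j` is `a * b⁻¹` with `a, b ∈ S_0[G]` (`G`
  finite) and `b` a unit of `O`;
* `exists_le_quadraticSeq` — **REACH**: a `k`-subalgebra `T ⊆ O` essentially of finite type over `k`
  lies in some member `S_N` of the quadratic sequence along `O` of a two-dimensional regular `R`
  dominated by `O` (Abhyankar's union lemma `AbhyankarQuadraticUnion_holds`: `⋃ S_j = O`; the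
  essential generators lie in some `S_N` and units of `T` are units of the `O`-dominated `S_N`);
* `isDiscreteValuationRing_placeOfPrime_of_localization` — if `B_𝔭` is a DVR then so is the place
  `placeOfPrime B 𝔭` of `K` (isomorphic localisations).

References: S. Abhyankar, Amer. J. Math. 78 (1956), Lemma 12 [`Abhyankar1956Valuations`];
O. Zariski, P. Samuel, *Commutative Algebra* II (1960), App. 5 [`ZariskiSamuel1960`].
-/

noncomputable section

-- single-problem summit: the doubled namespace component `ResolutionOfSingularities` is forced
set_option linter.dupNamespace false

namespace Summit.ResolutionOfSingularities.ResolutionOfSingularities.Theorems.NoZeno.SandwichCluster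

open IsLocalRing Literature.AlgebraicGeometry.Resolution Polynomial
open Summit.ResolutionOfSingularities.ResolutionOfSingularities.Theorems
open Summit.ResolutionOfSingularities.ResolutionOfSingularities.Theorems.NoZeno.Birth
open Summit.ResolutionOfSingularities.ResolutionOfSingularities.Theses.HomologicalConductor

variable {k K : Type} [Field k] [Field K] [Algebra k K]

/-! ## Finite presentation of the members of a quadratic sequence over the base -/

/-- **Members of a quadratic sequence are essentially finitely generated over the base**: for
every `j` there is a finite `G ⊆ S_j` such that every element of `S_j` is `a * b⁻¹` with `a, b` in
the subring generated by `S_0` and `G`, and `b` a unit of `O`. [folklore] -/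
theorem exists_finset_presentation_of_sequence (O : ValuationSubring K) (S : ℕ → Subring K)
    (hstep : ∀ i, IsQuadraticTransformAlong O (S i) (S (i + 1))) (j : ℕ) :
    ∃ G : Finset K, (↑G : Set K) ⊆ S j ∧ ∀ s ∈ S j, ∃ a ∈ Subring.closure ((S 0 : Set K) ∪ ↑G),
      ∃ b ∈ Subring.closure ((S 0 : Set K) ∪ ↑G), O.valuation b = 1 ∧ s = a * b⁻¹ := by
  classical
  induction j with
  | zero =>
    refine ⟨∅, by simp, fun s hs => ⟨s, Subring.subset_closure (Or.inl hs), 1,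
      Subring.one_mem _, by simp, by simp⟩⟩
  | succ j ih =>
    obtain ⟨G, hG, hpres⟩ := ih
    have hmono : S j ≤ S (j + 1) := (hstep j).le
    obtain ⟨_, hSO, u, u₀, hu, hu₀, h0, hval, heq⟩ := hstep j
    -- new generators: the quotients `y / u₀`
    let G' : Finset K := G ∪ u.image fun y : ↥(S j) => (y : K) / (u₀ : K)
    have hB : Subring.closure ((S j : Set K) ∪ (fun y : ↥(S j) => (y : K) / (u₀ : K)) '' ↑u) ≤
        S (j + 1) := by
      rw [heq]; exact le_locAtCentre _ O
    refine ⟨G', ?_, ?_⟩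
    · intro g hg
      rcases Finset.mem_union.mp (Finset.mem_coe.mp hg) with hg | hg
      · exact hmono (hG hg)
      · obtain ⟨y, hy, rfl⟩ := Finset.mem_image.mp hg
        exact hB (Subring.subset_closure (Or.inr ⟨y, hy, rfl⟩))
    -- the ring of presentable elements
    set C : Subring K := Subring.closure ((S 0 : Set K) ∪ ↑G') with hC
    have hGG' : Subring.closure ((S 0 : Set K) ∪ ↑G) ≤ C :=
      Subring.closure_mono (Set.union_subset_union_right _ (by
        intro g hg; exact Finset.mem_coe.mpr (Finset.mem_union_left _ (Finset.mem_coe.mp hg))))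
    -- every element of the chart ring is presentable
    have hchart : ∀ y ∈ Subring.closure ((S j : Set K) ∪ (fun y : ↥(S j) => (y : K) / (u₀ : K)) '' ↑u),
        ∃ a ∈ C, ∃ b ∈ C, O.valuation b = 1 ∧ y = a * b⁻¹ := by
      intro y hy
      induction hy using Subring.closure_induction with
      | mem z hz =>
        rcases hz with hz | ⟨w, hw, rfl⟩
        · obtain ⟨a, ha, b, hb, hvb, rfl⟩ := hpres z hz
          exact ⟨a, hGG' ha, b, hGG' hb, hvb, rfl⟩
        · refine ⟨(w : K) / (u₀ : K), Subring.subset_closure (Or.inr ?_), 1, C.one_mem,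
            by simp, by simp⟩
          exact Finset.mem_coe.mpr (Finset.mem_union_right _ (Finset.mem_image_of_mem _ hw))
      | zero => exact ⟨0, C.zero_mem, 1, C.one_mem, by simp, by simp⟩
      | one => exact ⟨1, C.one_mem, 1, C.one_mem, by simp, by simp⟩
      | add y z _ _ hy hz =>
        obtain ⟨a, ha, b, hb, hvb, rfl⟩ := hy
        obtain ⟨a', ha', b', hb', hvb', rfl⟩ := hz
        have hb0 := ne_zero_of_valuation_eq_one hvb
        have hb'0 := ne_zero_of_valuation_eq_one hvb'
        refine ⟨a * b' + a' * b, C.add_mem (C.mul_mem ha hb') (C.mul_mem ha' hb), b * b',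
          C.mul_mem hb hb', by rw [map_mul, hvb, hvb', one_mul], ?_⟩
        field_simp
      | neg y _ hy =>
        obtain ⟨a, ha, b, hb, hvb, rfl⟩ := hy
        exact ⟨-a, C.neg_mem ha, b, hb, hvb, by ring⟩
      | mul y z _ _ hy hz =>
        obtain ⟨a, ha, b, hb, hvb, rfl⟩ := hy
        obtain ⟨a', ha', b', hb', hvb', rfl⟩ := hz
        refine ⟨a * a', C.mul_mem ha ha', b * b', C.mul_mem hb hb',
          by rw [map_mul, hvb, hvb', one_mul], ?_⟩
        rw [mul_inv]; ring
    intro s hs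
    rw [heq] at hs
    obtain ⟨y, hy, z, hz, hvz, rfl⟩ := (mem_locAtCentre_iff).mp hs
    obtain ⟨a, ha, b, hb, hvb, rfl⟩ := hchart y hy
    obtain ⟨a', ha', b', hb', hvb', hz'⟩ := hchart z hz
    have hva' : O.valuation a' = 1 := by
      have h := hvz
      rw [hz', map_mul, map_inv₀, hvb', inv_one, mul_one] at h
      exact h
    refine ⟨a * b', C.mul_mem ha hb', b * a', C.mul_mem hb ha',
      by rw [map_mul, hvb, hva', one_mul], ?_⟩
    rw [hz']
    have := ne_zero_of_valuation_eq_one hvb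
    have := ne_zero_of_valuation_eq_one hvb'
    have := ne_zero_of_valuation_eq_one hva'
    field_simp

/-! ## Reach: a `k`-subalgebra essentially of finite type inside `O` lies in a member of the sequence -/

/-- **Reach.**  Let `R` be regular local of dimension two with `Frac R = K`, dominated by the
valuation ring `O`, and `T ⊇ R` a `k`-subalgebra of `O` essentially of finite type over `k`.  Then
`T ≤ S_N` for some member `S_N` of the quadratic sequence of `R` along `O` (Abhyankar's union lemma:
`⋃ S_j = O`; the finitely many essential generators of `T` lie in some `S_N`, and the units of `T`
are units of `O`, hence of the `O`-dominated `S_N`). [cite: Abhyankar1956Valuations, Lemma 12] -/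
theorem exists_le_quadraticSeq {R T : Subalgebra k K} [IsRegularLocalRing ↥R] [IsFractionRing ↥R K]
    (hdimR : ringKrullDim ↥R = 2) (O : ValuationSubring K)
    (hRO : SubringDominates R.toSubring O.toSubring)
    (hTO : T.toSubring ≤ O.toSubring) [hT : Algebra.EssFiniteType k ↥T] :
    ∃ N : ℕ, T.toSubring ≤ quadraticSeq O R.toSubring N := by
  classical
  haveI := isDomain_of_isRegularLocalRing (↥R)
  set seq : ℕ → Subring K := quadraticSeq O R.toSubring with hseq
  have hreg0 : IsRegularLocalRing ↥(seq 0) := ‹IsRegularLocalRing ↥R›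
  haveI : IsLocalRing ↥(seq 0) := hreg0.toIsLocalRing
  have hnf : ¬ IsField ↥(seq 0) := fun hF => by
    have h := ringKrullDim_eq_zero_of_isField hF
    have h' : ringKrullDim ↥R = 0 := h
    rw [hdimR] at h'
    exact absurd h' (by norm_num)
  have hstep : ∀ i, IsQuadraticTransformAlong O (seq i) (seq (i + 1)) := fun i =>
    RuledResiduesRegularModelRuled.isQuadraticTransformAlong_quadraticSeq_of_isRegularLocalRing
      hreg0 hnf hRO i
  have hmono : Monotone seq := sequence_monotone hstep
  have hdomO : ∀ i, SubringDominates (seq i) O.toSubring := fun i => (sequence_dominates hRO hstep i).1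
  have hof : IsLocalRingOf (seq 0) := by
    refine ⟨inferInstance, fun z => ?_⟩
    obtain ⟨a, b, hb, rfl⟩ := IsFractionRing.div_surjective (A := ↥R) z
    have hbK : (b : K) ≠ 0 := fun h => nonZeroDivisors.ne_zero hb (by exact_mod_cast h)
    exact ⟨(a : K), a.2, (b : K), b.2, hbK, rfl⟩
  have hdim0 : ringKrullDim ↥(seq 0) = 2 := hdimR
  have hunion := AbhyankarQuadraticUnion_holds K O seq hreg0 hdim0 hof hRO hstep
  -- the essential generators of `T`
  obtain ⟨σ, hσ⟩ := hT.cond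
  have hgen : ∀ t ∈ σ, ∃ i, ((t : ↥T) : K) ∈ seq i := fun t _ =>
    (hunion _).mp (hTO t.2)
  choose! idx hidx using hgen
  refine ⟨σ.sup idx, ?_⟩
  set N := σ.sup idx with hN
  have hσN : ∀ t ∈ σ, ((t : ↥T) : K) ∈ seq N := fun t ht =>
    hmono (Finset.le_sup ht) (hidx t ht)
  -- `T ≤ S_N`
  have hadj : ∀ x ∈ Algebra.adjoin k ((σ : Set ↥T)), ((x : ↥T) : K) ∈ seq N := by
    intro x hx
    induction hx using Algebra.adjoin_induction with
    | mem x hx => exact hσN x hx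
    | algebraMap c =>
      rw [Subalgebra.coe_algebraMap]
      exact hmono (Nat.zero_le N) (R.algebraMap_mem c)
    | add x y _ _ hx hy => rw [Subalgebra.coe_add]; exact (seq N).add_mem hx hy
    | mul x y _ _ hx hy => rw [Subalgebra.coe_mul]; exact (seq N).mul_mem hx hy
  intro s hs
  obtain ⟨t, ht, htu, hst⟩ := (Algebra.essFiniteType_cond_iff k ↥T σ).mp hσ ⟨s, hs⟩
  have htN : (t : K) ∈ seq N := hadj t ht
  have hstN : s * (t : K) ∈ seq N := by
    have := hadj _ hst
    rwa [Subalgebra.coe_mul] at this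
  obtain ⟨t', ht'⟩ := htu.exists_right_inv
  have htt' : (t : K) * (t' : K) = 1 := by
    have := congrArg (fun z : ↥T => (z : K)) ht'
    simpa using this
  have ht0 : (t : K) ≠ 0 := left_ne_zero_of_mul_eq_one htt'
  have htinvT : ((t : K))⁻¹ ∈ T := by
    rw [inv_eq_of_mul_eq_one_right htt']
    exact t'.2
  have htinvO : ((t : K))⁻¹ ∈ O := hTO htinvT
  have htinvN : ((t : K))⁻¹ ∈ seq N := (hdomO N).2 _ htN htinvO
  have hs' : s = s * (t : K) * ((t : K))⁻¹ := by rw [mul_assoc, mul_inv_cancel₀ ht0, mul_one]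
  rw [hs']
  exact (seq N).mul_mem hstN htinvN

/-! ## A DVR of `K` realised as `placeOfPrime` is a discrete valuation ring -/

/-- Transport: if `B_𝔭` (abstract localisation) is a discrete valuation ring then so is the place
`placeOfPrime B 𝔭` of `K` (the two are isomorphic localisations of `B` at `𝔭`). [folklore] -/
theorem isDiscreteValuationRing_placeOfPrime_of_localization (B : Subalgebra k K)
    [IsFractionRing ↥B K] (𝔭 : Ideal ↥B) [𝔭.IsPrime]
    [hdvr : IsDiscreteValuationRing (Localization.AtPrime 𝔭)] :
    IsDiscreteValuationRing ↥(placeOfPrime B 𝔭 inferInstance) := by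
  set W := placeOfPrime B 𝔭 (inferInstance : ValuationRing (Localization.AtPrime 𝔭)) with hW
  have hBW : B.toSubring ≤ W.toSubring := le_placeOfPrime B 𝔭 _
  letI : Algebra ↥B ↥W := (Subring.inclusion hBW : ↥B.toSubring →+* ↥W).toAlgebra
  haveI hloc := isLocalization_atPrime_of_model W (B := B) hBW
    (fun x hx => exists_mul_eq_of_mem_placeOfPrime B 𝔭 _ hx)
  have hcen : centreIdeal B W hBW = 𝔭 := centreIdeal_placeOfPrime B 𝔭 _
  have hM : (centreIdeal B W hBW).primeCompl = 𝔭.primeCompl := by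
    ext x
    change x ∉ centreIdeal B W hBW ↔ x ∉ 𝔭
    rw [hcen]
  haveI : IsLocalization 𝔭.primeCompl ↥W := hM ▸ hloc
  exact IsDiscreteValuationRing.RingEquivClass.isDiscreteValuationRing
    (IsLocalization.algEquiv 𝔭.primeCompl (Localization.AtPrime 𝔭) ↥W).toRingEquiv

end Summit.ResolutionOfSingularities.ResolutionOfSingularities.Theorems.NoZeno.SandwichCluster

end
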